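import Mathlib
import HarnessLib
import HarnessLib.Audit
import Summits.NavierStokesRegularity.Statement
import Summits.NavierStokesRegularity.NavierStokesRegularity.Theorems.NoBlowupToClay
import Literature.Analysis.FluidPDE.ClassicalSolution
import Literature.Analysis.FluidPDE.LerayHopf
import Literature.Analysis.FluidPDE.NSWave0
import Literature.Analysis.FluidPDE.VectorCalculus
import Literature.Analysis.FluidPDE.SuitableWeak
import HarnessLib.Audit.Status.Attr

/-!
Route: QuarterLogPincer

# Route QuarterLogPincer — Quarter-law dissipation caps the L3 cube at log; Type-I blow-up must
outgrow every log

D-0145 LINE (ideator seat ns-idea-3, technique card «splitting / non-equivalent criterion search»;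
bears_on rung N0 = Clay (A) through the shared RESIDUAL EnstrophyQuarterLaw
(stmt-NavierStokesRegularity-1574, a priori half, not attacked here) — no summit is proved by this
line). It suffices to show X = LogCubeSharp ∧ SuperlogCubeRate: two NON-EQUIVALENT blow-up criteria
that pinch IN ONE CURRENCY, the L³ cube. (Converter, rank 3, provable now) under the quarter law
‖ω(t)‖₂² ≤ K/√(T−t) and the velocity Type-I rate it forces (RecordTimeTypeI, PROVED, item 23363
closed), the L³ cube grows at most logarithmically, ‖u(t)‖₃³ ≤ C₁ + C₂ log(T/(T−t)) — the
TEMPLATE-SHARP rate (a |y|⁻¹-tailed Type-I profile has cube ≍ log), obtained by a two-rung energy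
ladder (L⁴ identity first, where sup|u| enters squared, then the L³ identity; no Hölder loss);
(deciding crux, rank 2) at a genuine velocity-Type-I first blow-up the L³ cube outgrows EVERY
affine-logarithmic envelope. Together with the residual quarter law, no classical Leray–Hopf
solution from a rapidly decaying datum has a first blow-up time, hence Clay (A). REV 4 (2026-08-28)
supersedes the rev-0 pair LogCubeCeiling / SuperlogTypeIRate (norm currency, cap one log^(2/3)
weaker than the template; banked `aside` together with the norm-road quantitative split
SubexpQuantESS → QuantBridge): the cap is now sharp and in the same growth class as the
Barker–Prange Type-I floor ∫|u(t)|³ ≥ c(A)·log(1/(T−t)), and the deciding crux is strictly WEAKER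
than SuperlogTypeIRate.
Lean: `LogCubeSharp ∧ SuperlogCubeRate` (decls of this file; frame =
`Literature.Analysis.FluidPDE.IsClassicalNSSolutionOn (Set.Ico 0 T) ν 0 u p`, `IsLerayHopfOn`,
`HasRapidSpatialDecay`, `IsTypeIBlowup`, `HasSmoothExtensionPast`, `MeasureTheory.eLpNorm (u t) 3
MeasureTheory.volume ^ 3`)

## Assembly
Pure logic (theorem `closes` in glue.lean, checked rc 0 in the planner's Sketch2.lean): by
`Theorems.navierStokesRegularity_of_noBlowup` it suffices that every classical Leray–Hopf solution
from a rapidly decaying datum extends past every T; if one did not, it is maximal,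
EnstrophyQuarterLaw gives K, RecordTimeTypeI gives the Type-I rate, LogCubeSharp gives (C₁,C₂)
bounding ‖u(t)‖₃³ for all t<T, and SuperlogCubeRate produces a t<T violating that bound —
contradiction.

Rationale: WHY THIS LINE. The splitting quantity is the L³-MASS DEPOSITION RATE PER E-FOLD of T−t, measured in
the CUBE ‖u(t)‖₃³. Jaw 1 (cap, rev 4 = the sharp converter LogCubeSharp): a two-rung energy ladder.
Rung 1, the L⁴ identity: d/dt∫|u|⁴ = −(viscous ≤ 0) − 4∫|u|²u·∇p, and |4∫p u·∇|u|²| ≤ 8∫|p||u|²|∇u|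
≤ 8‖u‖_∞²‖p‖₂‖∇u‖₂ ≤ 8C_R‖u‖_∞²‖u‖₄²‖ω‖₂ (Riesz: ‖p‖₂ ≤ C_R‖u‖₄²), so d/dt‖u‖₄² ≤ 4C_R
M(t)²Z(t)^(1/2) ≲ C_I²K^(1/2)(T−t)^(−5/4) under the Type-I rate M ≤ C_I(T−t)^(−1/2) and the quarter
law Z ≤ K(T−t)^(−1/2): ‖u(t)‖₄² ≤ W₀ + 16C_RC_I²K^(1/2)(T−t)^(−1/4) — exactly the template rate.
Rung 2, the L³ identity: d/dt∫|u|³ ≤ 3∫|p||u||∇u| ≤ 3‖u‖_∞‖p‖₂‖ω‖₂ ≤ 3C_R M‖u‖₄²Z^(1/2) ≲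
(integrable W₀-term) + 48C_R²C_I³K·(T−t)⁻¹, whence ‖u(t)‖₃³ ≤ C₁ + C₂ log(T/(T−t)) with C₂ =
48C_R²C_I³K. (The rev-0 road went through Hölder ‖u‖₄⁴ ≤ ‖u‖₃²‖u‖₆² and lost log^(2/3); using the
DYNAMICS of ‖u‖₄, where sup|u| enters squared, removes the loss.) Jaw 2 (floor): Barker–Prange (CMP
2021 = arXiv:2003.06717; survey arXiv:2211.16215 §7.1 p.14 Result 1) prove by quantitative unique
continuation (Carleman epochs/annuli of regularity) that at a weak-L³-Type-I singular point
∫_(B_R)|u(t)|³ ≥ log(R²/(A^802(T−t)))/exp(exp(A^1025)): the floor is logarithmic in the cube with a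
tiny constant. Cap and floor are now the SAME growth class; a backward-DSS / |y|⁻¹-tailed Type-I
profile has cube ≍ log and sits between them. The deciding crux SuperlogCubeRate asks the cube to
beat every C₁ + C₂ log at a velocity-Type-I blow-up, i.e. to exclude the slowly-depositing Type-I
scenario; quantitatively this is the o-improvement of BP21's single-exponential-in-the-cube Type-I
estimate (log F_M(A) = O_M(A³) known, o_M(A³) asked), not the removal of exponentials from Tao's
tower that the banked norm road needed. Imported area: quantitative unique continuation /
concentration (Tao 2019, Barker–Prange 2020–21, Palasek 2021) instead of the compactness–Liouville
back end of route LerayQuarterDissipation (same residual, different tool on the Type-I wall) and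
instead of the polynomial threshold of route SubcubicESS. No refuted statement of the negatives
index is used.

RANKED CRUXES. #2 SuperlogCubeRate (crux, deciding, open-problem; ON the DSS wall: false iff a
Type-I blow-up with cube = O(log) exists). #3 LogCubeSharp (crux, the converter, provable now, M;
STAFF FIRST; frozen-coefficient skeleton stub_l4Ladder / stub_l3FromL4 / stub_dyadicCube registered
on the item). #9 EnstrophyQuarterLaw (support, RESIDUAL, shared stmt-1574, not attacked). #9
RecordTimeTypeI (support, CLOSED: Theorems.quarterLogPincer_recordTimeTypeI_proof). Banked `aside`
(rev 0–1, norm currency, superseded, never staffed): SuperlogTypeIRate (23361; implies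
SuperlogCubeRate), LogCubeCeiling (23362; implied by LogCubeSharp), SubexpQuantESS (23631; implies
the cube-road child below; shelf sibling of SubcubicESS.SubcubicBound 10671 ⇒ 23631, evidence
attached), QuantBridge (23632), SuperlogTypeIRateGlue (23633).

TWO-LAYER PLAN. Foreseen split of SuperlogCubeRate (k = 2, bridge provable now):
TypeIQuantSubcubicExp (for every M a Tao-shape universal function F_M on Tao-class solutions on
[0,T] (ν = 1, all H^k bounded) that obey the virtual Type-I bound |u(t,x)| ≤ M(T+τ−t)^(−1/2) for
some τ > 0 and have L^∞_t L³_x history ≤ A, with log F_M(A) = o(A³); known: O_M(A³) under weak-L³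
Type I [BP21], exp exp exp(A^c) without Type I [Tao 2019 = tree fact tao_quantitative_ess]) →
CubeBridge (TypeIQuantSubcubicExp → SuperlogCubeRate: rescale to ν = 1, Tao cover on [0,t], cube
history ≤ C₁ + C₂ log(T/(T−t)) gives √(T−t)‖u(t)‖_∞ ≤ e^(εC₁)(T/(T−t))^(εC₂)·√((T−t)/t) → 0 once εC₂
< 1/2, contradicting the in-tree Leray-rate rung hasSmoothExtensionPast_of_rate_lt). Alternative
child on the qualitative side: a Liouville theorem for Type-I ancient mild solutions whose L³ mass
on B_R grows o(log R), meeting route LerayQuarterDissipation's RecurrentDissipativeLiouville from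
the L³ side.

KILL CRITERIA. Refutation of SuperlogCubeRate = exhibition of a velocity-Type-I blow-up with cube =
O(log(1/(T−t))) (in practice a backward-DSS / homogeneous-tailed Type-I blow-up): closes the route
`refuted:SuperlogCubeRate` AND kills LerayQuarterDissipation.FiniteDissipationLiouville (same
witness) — informative either way. Refutation of EnstrophyQuarterLaw retires this route together
with every quarter-law-fronted line. LogCubeSharp refuted would mean the L⁴/L³ bookkeeping is wrong
— pivot back to the banked norm-currency pair (LogCubeCeiling, whose squared-norm road ‖u‖₃² ≤ C₁ +
C₂ log is independent of the L⁴ rung, + SuperlogTypeIRate). NoTypeIBlowup (stmt-1217) proved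
elsewhere moots SuperlogCubeRate (vacuous) and the route collapses to EQL → RecordTimeTypeI → 1217.

NOT DECOMPOSED YET. The quantitative child TypeIQuantSubcubicExp and its bridge (Two-layer plan) are
not items at rev 4 (BC3 skeleton only); constants (C_R = Riesz L² bound; the Type-I constant C_I(K)
delivered by RecordTimeTypeI), the Tao-cover bookkeeping inside LogCubeSharp (differentiability of t
↦ ∫|u|⁴, ∫|u|³; pressure-slice decay), and the localized (B_R, R = (T−t)^(1/2−δ)) variants of both
jaws are layer-2 material.

CHEAPEST FALSIFIER. Run the two jaws on the explicit Type-I template u = (T−t)^(−1/2)U(x/√(T−t))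
with |U(y)| ≍ |y|⁻¹, |∇U| ≍ |y|⁻² at infinity (done by hand): enstrophy = (T−t)^(−1/2)∫|∇U|²
(quarter law saturated), ‖u(t)‖₄² ≍ (T−t)^(−1/4) (rung 1 saturated), ‖u(t)‖³_(L³(B_1)) ≍
log(1/(T−t)) (cap AND floor saturated in form) — the line lives exactly on «does a slowly-depositing
Type-I blow-up exist», now as a constants fight c_floor(A) = exp(−exp(A^1025)) [BP21] versus C_cap =
48C_R²C_I³K. Instrument row that refutes the key lemma: the pub-ns-dss backward-DSS profile search —
a converged nontrivial backward λ-DSS profile with ∇U ∈ L² refutes SuperlogCubeRate (and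
LerayQuarterDissipation.FiniteDissipationLiouville) at once; a certified empty search over a
λ-window extends NearOneDssTypeIExclusion and is a rung.

NUMBERS. Floor (BP21, survey arXiv:2211.16215 p.14 Result 1): under A = ‖u‖_(L^∞_t L^(3,∞)_x) < ∞,
∫_(|x|<R)|u(x,t)|³ ≥ log(R²/(A^802(T−t)))/exp(exp(A^1025)) for R ∈ (√((T−t)/S(A)), e^(A^1022)√T),
S(A) ≍ A^(−30); BP21 regularity time t_* = −A^(−c)exp(−exp exp(A^1024)·∫_(B(exp(A^1023)))|u(·,0)|³)
(single exponential in the cube). General rate without Type I (Tao 2019 Thm 1.4): limsup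
‖u(t)‖₃/(log log log(1/(T−t)))^c = ∞. Cap (rev 4): ‖u(t)‖₄² ≤ ‖u(t₁)‖₄² +
16C_RC_I²K^(1/2)(T−t)^(−1/4); ‖u(t)‖₃³ ≤ ‖u(t₁)‖₃³ + O(1) + 48C_R²C_I³K log((T−t₁)/(T−t)).
Leray-rate rung used by the bridge: hasSmoothExtensionPast_of_rate_lt needs eventual √(T−t)‖u(t)‖_∞
≤ C√ν with (√3+√6)C/9 < 1.

DEFINITION REQUESTS. None: L³/L⁴ slices are `MeasureTheory.eLpNorm (u t) 3|4 MeasureTheory.volume`;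
weak-L³ vocabulary (Literature.Analysis.FunctionSpaces.WeakLp) is available for the
localized/Lorentz variants of layer 2.

Novelty: Searches (2026-08-27/28): rg over all 124 NS Theses for "log (T", "Real.log", "eLpNorm (u t) 3",
"WeakL3|3,∞" (L³-slice statements only in SubcubicESS [F(A)=o(A³)], L3TimeExponentPincer
[time-integrability exponents], LebesgueExponentPincer [space exponents]; no route states an L³
growth RATE against T−t); lit search --hybrid "Type I blow-up Navier-Stokes L3 norm logarithmic rate
quantitative Barker Prange" (8 docs; [corpus:paper:arxiv-2211.16215 p.14] Result 1 = the log floor,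
[corpus:paper:arxiv-2311.00711 p.3] restates it); lit vsearch "under a Type I bound the L3 norm …
grows at least logarithmically" (6 book hits, none on point: [corpus:book:seregin2014 pp.129–139]
ESS/backward uniqueness, [corpus:book:robinson2016 p.201,205] the interpolation and Riesz
ingredients of the cap); lit galaxy search "Type I blow-up|quantitative regularity|blow-up rate of
the critical" --star all ([galaxy:pdf:3327933239271363760] Palasek 2101.08586 improved quantitative
regularity; panama/crabby no relevant hits); ledger negatives (5 entries, none on L³ rates).
Nearest prior art found: arXiv:2003.06717 / arXiv:2211.16215 §7.1 (Barker–Prange: log floor of the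
localized L³ cube under weak-L³ Type I — the floor jaw, one power of log); route SubcubicESS
(stmt-10671: sub-cubic Tao function suffices, paid by the energy); route LerayQuarterDissipation
(same residual, Liouville back end).
Delta: nobody pairs a dissipation-rate criterion with a critical-norm-rate criterion: the quarter
law converts (p  [refs: 2003.06717, 2211.16215, paper:arxiv-2211.16215, paper:arxiv-2311.00711, book:seregin2014, book:robinson2016]

Barriers (technique_class: quantitative-unique-continuation, critical-norm-rate): - technique_class: quantitative-unique-continuation, critical-norm-rate
- Literature.Barriers.NavierStokesRegularity.CriticalNormBlowupNecessity: consistent, not an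
obstacle — the line strengthens «‖u(t)‖₃ → ∞ at blow-up» (Seregin 2012; Tao triple-log rate) to
«faster than every log» in the Type-I class; the barrier's facts (ess_endpoint, seregin_L3_blowup,
tao_L3_blowup_rate) are the rung-zero of SuperlogTypeIRate.
- Literature.Barriers.NavierStokesRegularity.AveragedTypeIBlowup: it does not evade on the residual
side — Tao's averaged blow-up violates the quarter law, so EnstrophyQuarterLaw must use fine NS
structure (the declared residual carries the supercriticality, as on route LerayQuarterDissipation);
the attacked cruxes sit outside: LogCubeCeiling uses the exact transport cancellation ∫|u|u·(u·∇)u =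
0 and the local Riesz pressure law, SuperlogTypeIRate uses backward uniqueness/Carleman (Tao 2016
§1.1: ESS-type arguments are «not manifestly subject to» the averaging barrier).
- Literature.Barriers.NavierStokesRegularity.EnergySupercriticality: outside for the attacked half —
both jaws are scale-invariant statements (log of the dimensionless T/(T−t)); the supercritical gap
is confined to the residual EnstrophyQuarterLaw.
- Literature.Barriers.NavierStokesRegularity.EnstrophyODENoGlobalClosure: outside — no enstrophy ODE
is closed; the quarter law enters as a hypothesis and is spent linearly (∫‖u‖_∞‖∇u‖₂² dt), never
cubed.
- Literature.Barriers.NavierStokesRegularity.Vort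

History (route lifecycle, newest last):
- 2026-08-27T23:45:20Z · rev 2: informal re-worded for SuperlogTypeIRate (planner-ns-idea-3-g2-0)
- 2026-08-27T23:46:10Z · rev 3: informal re-worded for LogCubeCeiling (planner-ns-idea-3-g2-0)
- 2026-08-28T00:34:49Z · rev 9: informal re-worded for TypeIQuantSubcubicExp (planner-ns-idea-3-g2-0)

sub-problem: NavierStokesRegularity · status: open · opened planner-ns-idea-3-g2-0 2026-08-27T23:10:20Z · rev 9 · ledger route-NavierStokesRegularity-QuarterLogPincer
GENERATED by the gate from the ledger (D-0016/17). Provers cite these decls: `theorem foo : Summit.NavierStokesRegularity.NavierStokesRegularity.Theses.QuarterLogPincer.<Decl> := …` in Summits/NavierStokesRegularity/NavierStokesRegularity/Theorems/<Name>.lean.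
-/

namespace Summit.NavierStokesRegularity.NavierStokesRegularity.Theses.QuarterLogPincer

open scoped BigOperators Topology Manifold Classical MeasureTheory ProbabilityTheory Matrix InnerProductSpace ComplexConjugate ContinuousMap
open Filter Set Function TopologicalSpace MeasureTheory

attribute [summit_statement] _root_.NavierStokesRegularity

open Literature.NS

/-- item stmt-NavierStokesRegularity-23934 · crux · rank 2 · SPLIT (gen 1) into TypeIQuantSubcubicExp, CubeBridge + glue SuperlogCubeRateGlue · direct attempts still welcome (low priority) · by planner
why it might fail: Any velocity-Type-I blow-up whose profile has |y|⁻¹ tails (backward λ-DSS, open for λ away from 1: Chae–Wolf 2017, Bradshaw–Tsai) has ‖u(t)‖₃³ ≍ log(1/(T−t)) and refutes it; equivalently BP21's O_M(A³) may be sharp.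
sources: arXiv:2211.16215, arXiv:2003.06717, arXiv:1908.04958, arXiv:1610.09464, arXiv:2101.08586, Literature.Barriers.NavierStokesRegularity.NearOneDssTypeIExclusion
[crux] SUPER-LOGARITHMIC L³ CUBE AT VELOCITY-TYPE-I BLOW-UP (rev 4 deciding crux; WEAKER than
SuperlogTypeIRate and in the SAME currency as the Barker–Prange Type-I floor ∫|u(t)|³ ≥
c(A)·log(1/(T−t)) [arXiv:2211.16215 p.14, BP21]). A classical solution of unforced NS on ℝ³×[0,T)
(ν,T>0), Leray–Hopf from its rapidly decaying datum, with NO smooth extension past T and the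
velocity Type-I rate, has, for every pair C₁ C₂, a time t<T with ‖u(t)‖₃³ > C₁ + C₂ log(T/(T−t)).
Implied by NoTypeI (stmt-1217: hypotheses then contradictory). Honest status: FALSE iff a Type-I
blow-up with cube = O(log(1/(T−t))) exists — every backward-DSS / |y|⁻¹-tailed Type-I profile is
such (cube ≍ log exactly), so this crux sits ON the DSS wall (Bradshaw–Tsai OP; Chae–Wolf λ-DSS
existence open for λ away from 1). Why this is the right ask: with the sharp converter LogCubeSharp
the pincer's cap (cube ≤ C₁+C₂(κ,C_I)·log) and the literature floor (cube ≥ c(A)·log) are the SAME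
growth class; the remaining gap is a constants fight c_floor vs C_cap, and the quantitative layer-2
child is the o-improvement of BP21's single-exponential-in-the-cube Type-I estimate (log F_M(A) =
O_M(A³) known → o_M(A³) asked), not two ex -/
@[route_item "route-NavierStokesRegularity-QuarterLogPincer", crux]
def SuperlogCubeRate : Prop :=
  ∀ (ν T : ℝ), 0 < ν → 0 < T → ∀ (u : ℝ → EuclideanSpace ℝ (Fin 3) → EuclideanSpace ℝ (Fin 3)) (p : ℝ → EuclideanSpace ℝ (Fin 3) → ℝ), Literature.Analysis.FluidPDE.IsClassicalNSSolutionOn (Set.Ico 0 T) ν 0 u p → Literature.Analysis.FluidPDE.IsLerayHopfOn T ν 0 (u 0) u → Literature.Analysis.FluidPDE.HasRapidSpatialDecay (u 0) → ¬ Literature.Analysis.FluidPDE.HasSmoothExtensionPast ν 0 u T → Literature.Analysis.FluidPDE.IsTypeIBlowup u T → ∀ C₁ C₂ : ℝ, ∃ t ∈ Set.Ico 0 T, ENNReal.ofReal (C₁ + C₂ * Real.log (T / (T - t))) < MeasureTheory.eLpNorm (u t) 3 MeasureTheory.volume ^ (3 : ℕ)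

-- parent: SuperlogCubeRate · child (gen 1)
/--     item stmt-NavierStokesRegularity-24077 · crux · rank 201 · open
    parent: SuperlogCubeRate · by planner
    why it might fail: A backward-DSS Type-I blow-up (existence open, Bradshaw–Tsai) has cube ≍ c·log(1/(T−t)), forcing log F_M(A) ≥ A³/(2c); BP21 Prop. 2's linear-in-cube law may already be sharp in the Type-I class.
    sources: doi:10.1007/s00220-021-04122-x, arXiv:2003.06717, arXiv:2211.16215, arXiv:1908.04958, arXiv:1610.09464, Tao2021QuantitativeNS
[crux] QUANTITATIVE ESS AT THE BARKER–PRANGE BOUNDARY (layer-2 child of SuperlogCubeRate). For every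
M a Tao-shape universal F_M on Tao-class solutions (nu = 1, H^k slices bounded on [0,T]) obeying the
SUP-RATE bound |u(t,x)| <= M (T+tau-t)^{-1/2} (tau > 0) and the L^3 history sup_t ||u(t)||_3 <= A, A
>= 2, with |u(t,x)| <= F_M(A) t^{-1/2} and log F_M(A) = o(A^3). PRINTED LINE IT IS MEASURED AGAINST:
Barker–Prange, Comm. Math. Phys. 385 (2021), doi:10.1007/s00220-021-04122-x = arXiv:2003.06717,
PROPOSITION 2 (main quantitative estimate, Type I): under the WEAK-L^3 Type-I bound ||u||_{L^inf_t
L^{3,inf}_x} <= M (M >= M_2 universal) the dissipative time is -s_0 = (C#/16) M^{-749} exp{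
-exp(exp(M^{1024})) * Int_{B(exp(M^{1023}) T^{1/2})} |u(x,t_0)|^3 dx } with ||u||_{L^inf} <= C_1
M^{-23} (-s_0)^{-1/2} T^{-1/2} on the final region; i.e. log F is LINEAR in the final-time local
CUBE with slope (1/2) exp(exp(M^{1024})) — 'O_M(A^3)' with a double-exponential constant in M;
THEOREM 1 ibid. is the rate floor cube >= log(1/(T*-t)^{delta/2}) / exp(exp(M^{1025}))
[corpus:paper:arxiv-2003.06717 p.3, p.10]. CAVEAT (typing): BP's Type I is weak-L^3; this item's is
the sup-rate bound that IsTypeIBl -/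
@[route_item "route-NavierStokesRegularity-QuarterLogPincer", crux (bottleneck := work) (experiment := "instrument: 28⟩ (Q4) ATTACKABLE = TRIPWIRE (v9 split Q4line/Q4curved/Q4sonic) · W6 ⟨25311⟩ IDEA-NEEDED (stub ≡ crux `HemisphereLiouvilleE3`; 14 LEAD ge…") (source := "director HOURLY-NS l.1327, 2026-09-01")]
def TypeIQuantSubcubicExp : Prop :=
  ∀ M : ℝ, ∃ F : ℝ → ℝ, (∀ ε : ℝ, 0 < ε → ∃ A₀ : ℝ, ∀ A : ℝ, A₀ ≤ A → F A ≤ Real.exp (ε * A ^ 3)) ∧ ∀ (T τ A : ℝ) (u : ℝ → EuclideanSpace ℝ (Fin 3) → EuclideanSpace ℝ (Fin 3)) (p : ℝ → EuclideanSpace ℝ (Fin 3) → ℝ), (Literature.Analysis.FluidPDE.IsClassicalNSSolutionOn (Set.Icc 0 T) 1 0 u p ∧ ∀ n : ℕ, ∃ C : NNReal, ∀ t ∈ Set.Icc 0 T, MeasureTheory.eLpNorm (iteratedFDeriv ℝ n (u t)) 2 MeasureTheory.volume ≤ C) → 0 < τ → (∀ t ∈ Set.Icc 0 T, ∀ x :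 EuclideanSpace ℝ (Fin 3), ‖u t x‖ ≤ M * (T + τ - t) ^ (-(1 / 2 : ℝ))) → (∀ t ∈ Set.Icc 0 T, MeasureTheory.eLpNorm (u t) 3 MeasureTheory.volume ≤ ENNReal.ofReal A) → 2 ≤ A → ∀ t ∈ Set.Ioc 0 T, ∀ x : EuclideanSpace ℝ (Fin 3), ‖u t x‖ ≤ F A * t ^ (-(1 / 2 : ℝ))

-- parent: SuperlogCubeRate · child (gen 1)
/--     item stmt-NavierStokesRegularity-24078 · support · rank 202 · closed · proved by Summit.NavierStokesRegularity.NavierStokesRegularity.Theorems.CubeBridge.cubeBridge_proof (prover)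
    parent: SuperlogCubeRate · by planner
    sources: arXiv:1908.04958, Leray1934, Tao2021QuantitativeNS
[support] THE CUBE BRIDGE (provable now, size L; template = Theorems.subcubicESS_energyBridge_proof
+ the Leray-rate rung hasSmoothExtensionPast_of_rate_lt, as for QuantBridge 23632 with A replaced by
the cube): fix nu, T, u, p with no smooth extension past T, IsTypeIBlowup u T and suppose the cube
history is <= C_1 + C_2 log(T/(T-t)) on [0,T). Rescale to nu = 1; on each [0,t], t < T, the Tao
cover (tao2011_hasBoundedSobolevNormsOn_holds / RungReynoldsOne.stub_taoCover) puts u in the Tao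
class; the eventual Type-I bound sup|u(s)| <= C_I (T-s)^{-1/2} is a virtual Type-I bound with tau =
T - t (earlier times bounded by the slab cover, enlarging M); apply TypeIQuantSubcubicExp with A^3 =
C_1 + C_2 log(T/(T-t)) and eps with eps C_2 < 1/2: sqrt(T-t) ||u(t)||_inf <= F_M(A) sqrt((T-t)/t) <=
e^{eps C_1} (T/(T-t))^{eps C_2} sqrt((T-t)/t) -> 0 as t -> T, so the rate is o((T-t)^{-1/2}) and
hasSmoothExtensionPast_of_rate_lt extends u past T — contradiction; hence for all C_1 C_2 some slice
has cube > C_1 + C_2 log, i.e. SuperlogCubeRate. -/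
@[route_item "route-NavierStokesRegularity-QuarterLogPincer"]
def CubeBridge : Prop :=
  TypeIQuantSubcubicExp → SuperlogCubeRate

-- `CubeBridge` holds: proved by `Summit.NavierStokesRegularity.NavierStokesRegularity.Theorems.CubeBridge.cubeBridge_proof` (its module imports this route file, so no `_holds` link can be stated here).

-- parent: SuperlogCubeRate · glue (gen 1)
/--     item stmt-NavierStokesRegularity-24079 · support · rank 203 · closed · proved by Summit.NavierStokesRegularity.NavierStokesRegularity.Theorems.quarterLogPincer_superlogCubeRateGlue_proof (prover)
    parent: SuperlogCubeRate · GLUE: children ⟹ parent · by planner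
[glue] modus ponens: TypeIQuantSubcubicExp → (TypeIQuantSubcubicExp → SuperlogCubeRate) →
SuperlogCubeRate (trivial seam, declared; the content is in the two children: the o_M(A³)
quantitative ESS at the Barker–Prange boundary, and the provable cube bridge via the Leray-rate
rung). -/
@[route_item "route-NavierStokesRegularity-QuarterLogPincer"]
def SuperlogCubeRateGlue : Prop :=
  TypeIQuantSubcubicExp → CubeBridge → SuperlogCubeRate

-- `SuperlogCubeRateGlue` holds: proved by `Summit.NavierStokesRegularity.NavierStokesRegularity.Theorems.quarterLogPincer_superlogCubeRateGlue_proof` (its module imports this route file, so no `_holds` link can be stated here).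

/-- item stmt-NavierStokesRegularity-23935 · crux · rank 3 · closed · proved by Summit.NavierStokesRegularity.NavierStokesRegularity.Theorems.LogCubeSharp.logCubeSharp_proof (prover) · by planner
why it might fail: It should not (L⁴-then-L³ energy identities with ‖p‖₂ ≤ C_R‖u‖₄², sup|u| used twice in the L⁴ rung; dyadic summation); risks are formal: differentiability of ∫|u|⁴, ∫|u|³ in t, pressure-slice decay (Tao H^k cover on [0,t]), eventual Type I.
sources: book:robinson2016-three-dimensional-navier-stokes-equations-classical-theory, arXiv:1908.04958, arXiv:2211.16215, EscauriazaSereginSverak2003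
[crux] SHARP LOGARITHMIC CUBE CEILING (rev 4 converter; answers the critic's P1(a): the template
rate IS provable). A classical solution on [0,T), Leray–Hopf from a rapidly decaying datum, obeying
the quarter-rate enstrophy bound Z(t)=∫|curl u(t)|² ≤ K/√(T−t) on [0,T) and the velocity Type-I rate
|u| ≤ C_I/√(T−t) (eventually), satisfies ‖u(t)‖₃³ ≤ C₁ + C₂ log(T/(T−t)) on [0,T). ROAD (two-rung
ladder, no Hölder loss): (1) L⁴ identity d/dt∫|u|⁴ ≤ 8∫|p||u|²|∇u| ≤ 8‖u‖∞²‖p‖₂‖∇u‖₂ ≤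
8C_R‖u‖∞²‖u‖₄²Z^{1/2} ⇒ d/dt‖u‖₄² ≤ 4C_R M(t)² Z(t)^{1/2} ≲ C_I²K^{1/2}(T−t)^{-5/4} ⇒ ‖u(t)‖₄² ≤ W₀
+ 16C_RC_I²K^{1/2}(T−t)^{-1/4} (template-sharp); (2) L³ identity d/dt∫|u|³ ≤ 3∫|p||u||∇u| ≤
3‖u‖∞‖p‖₂Z^{1/2} ≤ 3C_R M‖u‖₄²Z^{1/2} ≲ (T−t)^{-3/4}·W₀-term + 48C_R²C_I³K·(T−t)⁻¹ ⇒ cube ≤ C₁ + C₂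
log(T/(T−t)) with C₂ = 48C_R²C_I³K. Frozen-coefficient skeleton (stub_l4Ladder, stub_l3FromL4,
stub_dyadicCube) registered on the item. Typing/formal risks only: differentiability of t ↦ ∫|u|⁴,
∫|u|³ and decay of the pressure slices for classical solutions (Tao H^k cover on sub-slabs [0,t]),
eventual Type I (bound [0,t₁] by the cover), eLpNorm(u t) 3 < ⊤. Implies LogCubeCeiling (norm ≤ 1 +
cube). STAFF FIRST. [difficulty: -/
@[route_item "route-NavierStokesRegularity-QuarterLogPincer", crux]
def LogCubeSharp : Prop :=
  ∀ (ν T : ℝ), 0 < ν → 0 < T → ∀ (u : ℝ → EuclideanSpace ℝ (Fin 3) → EuclideanSpace ℝ (Fin 3)) (p : ℝ → EuclideanSpace ℝ (Fin 3) → ℝ), Literature.Analysis.FluidPDE.IsClassicalNSSolutionOn (Set.Ico 0 T) ν 0 u p → Literature.Analysis.FluidPDE.IsLerayHopfOn T ν 0 (u 0) u → Literature.Analysis.FluidPDE.HasRapidSpatialDecay (u 0) → ∀ K : ℝ, (∀ t ∈ Set.Ico 0 T, ∫⁻ x, ‖Literature.Analysis.FluidPDE.curl (u t) x‖ₑ ^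 2 ≤ ENNReal.ofReal (K / Real.sqrt (T - t))) → Literature.Analysis.FluidPDE.IsTypeIBlowup u T → ∃ C₁ C₂ : ℝ, ∀ t ∈ Set.Ico 0 T, MeasureTheory.eLpNorm (u t) 3 MeasureTheory.volume ^ (3 : ℕ) ≤ ENNReal.ofReal (C₁ + C₂ * Real.log (T / (T - t)))

-- `LogCubeSharp` holds: proved by `Summit.NavierStokesRegularity.NavierStokesRegularity.Theorems.LogCubeSharp.logCubeSharp_proof` (its module imports this route file, so no `_holds` link can be stated here).

/-- item stmt-NavierStokesRegularity-23361 · aside · rank 2 · SPLIT (gen 1) into SubexpQuantESS, QuantBridge + glue SuperlogTypeIRateGlue · direct attempts still welcome (low priority) · by planner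
why it might fail: A backward λ-DSS (or asymptotically homogeneous-tailed) Type-I blow-up, open for all λ not near 1 (Chae–Wolf 2017, Bradshaw–Tsai), deposits L³ mass at a CONSTANT rate per e-fold: ‖u(t)‖₃³ ≍ log(1/(T−t)) — the crux is false iff such a blow-up exists.
sources: arXiv:2003.06717, arXiv:2211.16215, arXiv:1908.04958, arXiv:2101.08586, arXiv:1610.09464, Literature.Barriers.NavierStokesRegularity.NearOneDssTypeIExclusion
[crux] SUPER-LOGARITHMIC L³ RATE AT VELOCITY-TYPE-I BLOW-UP. A classical solution of unforced NS on
ℝ³×[0,T) (ν,T>0), Leray–Hopf from its rapidly decaying datum, with NO smooth extension past T and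
the velocity Type-I rate (IsTypeIBlowup u T), has, for every pair C₁ C₂, a time t<T with ‖u(t)‖_(L³)
> C₁ + C₂ log(T/(T−t)). HONEST CURRENCY NOTE (critic idea-crit-3 P1, 2026-08-27): on the |U| ≍ |y|⁻¹
(backward-DSS-tailed) Type-I template the L³ CUBE grows like log(T/(T−t)) and the NORM like
log^{1/3}; the companion converter LogCubeCeiling delivers, on the L³-identity road, at best
‖u(t)‖₃² ≤ C₁ + C₂ log (cube ≤ C log^{3/2}; skeleton v2 on stmt-23362) — a cube ≤ C·log converter
would need SPATIAL Type I (|u| ≲ |x−x₀|⁻¹), unavailable under the quarter law. So this crux, as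
typed (norm beats every affine log), OVER-ASKS by log^{1/2} in the norm relative to the converter
and by log^{2/3} relative to the template; every Type-I blow-up with ‖u(t)‖₃ = O(log), in particular
any backward-DSS-tailed one, refutes it (same instrument: pub-ns-dss backward λ-DSS profile with ∇U
∈ L²). Floor in print: Barker–Prange 2021 cube ≥ c·log under weak-L³ Type I. Split (gen 1):
SubexpQuantESS (stmt-23631) → -/
@[route_item "route-NavierStokesRegularity-QuarterLogPincer", crux]
def SuperlogTypeIRate : Prop :=
  ∀ (ν T : ℝ), 0 < ν → 0 < T → ∀ (u : ℝ → EuclideanSpace ℝ (Fin 3) → EuclideanSpace ℝ (Fin 3)) (p : ℝ → EuclideanSpace ℝ (Fin 3) → ℝ), Literature.Analysis.FluidPDE.IsClassicalNSSolutionOn (Set.Ico 0 T) ν 0 u p → Literature.Analysis.FluidPDE.IsLerayHopfOn T ν 0 (u 0) u → Literature.Analysis.FluidPDE.HasRapidSpatialDecay (u 0) → ¬ Literature.Analysis.FluidPDE.HasSmoothExtensionPast ν 0 u T → Literature.Analysis.FluidPDE.IsTypeIBlowup u T → ∀ C₁ C₂ : ℝ, ∃ t ∈ Set.Ico 0 T,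 ENNReal.ofReal (C₁ + C₂ * Real.log (T / (T - t))) < MeasureTheory.eLpNorm (u t) 3 MeasureTheory.volume

-- parent: SuperlogTypeIRate · child (gen 1)
/--     item stmt-NavierStokesRegularity-23631 · crux · rank 201 · open
    parent: SuperlogTypeIRate · by planner
    why it might fail: Two exponentials below Tao 2019 (F ≤ exp exp exp(A^c)) and one below the axisymmetric exp exp (Palasek 2021): Carleman quantification may be essentially sharp; a |y|⁻¹-tailed Type-I blow-up forces log F(A) ≳ A³, refuting o(A).
    sources: arXiv:1908.04958, arXiv:2101.08586, arXiv:2211.16215, arXiv:2003.06717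
[crux] SUBEXPONENTIAL QUANTITATIVE ESS (the quantitative child of SuperlogTypeIRate; LINE B of
ideator seat ns-idea-3 g2, splitting card: the pincer's deciding jaw re-typed in Tao's quantitative
currency). Tao-shape velocity bound in Tao's class (nu = 1, H^k classical solutions on [0,T], L^3
history sup_t ||u(t)||_3 <= A, A >= 2  =>  |u(t,x)| <= F(A) t^{-1/2}) with a size function F that is
SUBEXPONENTIAL: for every eps > 0, F(A) <= exp(eps A) for A large. Known: F(A) = exp exp
exp(A^{O(1)}) (Tao 2019 Thm 1.2, tree fact Literature.Analysis.FluidPDE.tao_quantitative_ess); exp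
exp in the axisymmetric class (Palasek 2021); under weak-L^3 Type I the localized L^3 cube carries a
log floor (Barker-Prange 2021). Strictly WEAKER than route SubcubicESS's SubcubicBound (F(A) =
o(A^3) implies F(A) <= exp(eps A)); the quarter law pays the difference: with LogCubeCeiling the L^3
history is A(t) = C1 + C2 log(T/(T-t)), and F(A(t)) <= e^{eps C1} (T/(T-t))^{eps C2} with eps C2 <
1/2 beats the Leray rate. No summit is proved by this line. -/
@[route_item "route-NavierStokesRegularity-QuarterLogPincer"]
def SubexpQuantESS : Prop :=
  ∃ F : ℝ → ℝ, (∀ ε : ℝ, 0 < ε → ∃ A₀ : ℝ, ∀ A : ℝ, A₀ ≤ A → F A ≤ Real.exp (ε * A)) ∧ ∀ (T A : ℝ) (u : ℝ → EuclideanSpace ℝ (Fin 3) → EuclideanSpace ℝ (Fin 3)) (p : ℝ → EuclideanSpace ℝ (Fin 3) → ℝ), (Literature.Analysis.FluidPDE.IsClassicalNSSolutionOn (Set.Icc 0 T) 1 0 u p ∧ ∀ n : ℕ, ∃ C : NNReal, ∀ t ∈ Set.Icc 0 T, MeasureTheory.eLpNorm (iteratedFDeriv ℝ n (u t)) 2 MeasureTheory.volume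 ≤ C) → (∀ t ∈ Set.Icc 0 T, MeasureTheory.eLpNorm (u t) 3 MeasureTheory.volume ≤ ENNReal.ofReal A) → 2 ≤ A → ∀ t ∈ Set.Ioc 0 T, ∀ x : EuclideanSpace ℝ (Fin 3), ‖u t x‖ ≤ F A * t ^ (-(1 / 2 : ℝ))

-- parent: SuperlogTypeIRate · child (gen 1)
/--     item stmt-NavierStokesRegularity-23632 · support · rank 202 · closed · proved by Summit.NavierStokesRegularity.NavierStokesRegularity.Theorems.QuantBridge.quantBridge_proof (prover)
    parent: SuperlogTypeIRate · by planner
    sources: arXiv:1908.04958, Tao2021QuantitativeNS, Leray1934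
[support] THE QUANTITATIVE BRIDGE (provable now, size L, ~200 lines on the template of
Theorems.subcubicESS_energyBridge_proof + hasSmoothExtensionPast_of_rate_lt): a subexponential Tao
function forces the super-logarithmic L^3 rate at every first blow-up of a classical Leray-Hopf
solution from a rapidly decaying datum. Proof: fix nu, T, u, p with no smooth extension past T and
suppose ||u(t)||_3 <= C1 + C2 log(T/(T-t)) on [0,T); for t < T restrict to [0,t], Tao class by
tao2011_hasBoundedSobolevNormsOn_holds, rescale w(s,x) = nu^{-1} u(s/nu, x) to viscosity 1
(IsClassicalNSSolutionOn.viscosityRescale_zero), apply the velocity clause with A(t) = max(2,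
nu^{-1}(C1 + C2 log(T/(T-t)))) and eps := nu/(4 C2 + 1): |u(t,x)| <= nu F(A(t)) (nu t)^{-1/2} <= K
(T-t)^{-1/4}-type bound for t >= T/2, so sqrt(T-t) sup_x |u(t,x)| -> 0 as t -> T, in particular
eventually <= c sqrt(nu) with ((sqrt 3 + sqrt 6)/9) c < 1, and hasSmoothExtensionPast_of_rate_lt
(Theorems/TypeICertificateLadderTargetStrainCubeRung.lean) gives HasSmoothExtensionPast nu 0 u T,
contradiction. The Type-I hypothesis of SuperlogTypeIRate is not used. -/
@[route_item "route-NavierStokesRegularity-QuarterLogPincer"]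
def QuantBridge : Prop :=
  SubexpQuantESS → SuperlogTypeIRate

-- `QuantBridge` holds: proved by `Summit.NavierStokesRegularity.NavierStokesRegularity.Theorems.QuantBridge.quantBridge_proof` (its module imports this route file, so no `_holds` link can be stated here).

-- parent: SuperlogTypeIRate · glue (gen 1)
/--     item stmt-NavierStokesRegularity-23633 · aside · rank 203 · closed · proved by Summit.NavierStokesRegularity.NavierStokesRegularity.Theorems.quarterLogPincer_superlogTypeIRateGlue_proof (prover)
    parent: SuperlogTypeIRate · GLUE: children ⟹ parent · by planner
SubexpQuantESS → QuantBridge → SuperlogTypeIRate: modus ponens (fun h₁ h₂ => h₂ h₁); the analytic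
content of the split is QuantBridge (provable now), the open quantitative child is SubexpQuantESS
(log F(A) = o(A)); BC7 2/2 CLEAN (QuantBridge P3 rerun 90 s clean), BC2/BC3 probes child→crux and
child→summit FAIL 4/4, BC4 exact? fails; registered BC3 skeleton on stmt-23361 carries the same two
statements as stubs. -/
@[route_item "route-NavierStokesRegularity-QuarterLogPincer"]
def SuperlogTypeIRateGlue : Prop :=
  SubexpQuantESS → QuantBridge → SuperlogTypeIRate

-- `SuperlogTypeIRateGlue` holds: proved by `Summit.NavierStokesRegularity.NavierStokesRegularity.Theorems.quarterLogPincer_superlogTypeIRateGlue_proof` (its module imports this route file, so no `_holds` link can be stated here).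

/-- item stmt-NavierStokesRegularity-23362 · aside · rank 3 · closed · proved by Summit.NavierStokesRegularity.NavierStokesRegularity.Theorems.LogCubeCeiling.logCubeCeiling_proof (prover) · by planner
why it might fail: It should not (L³ energy identity + Riesz + ‖u‖₄⁴ ≤ ‖u‖₃²‖u‖₆², Gronwall in Y^(1/3)); risks are formal: differentiability of ‖u(t)‖₃³ and decay of p|u|² slices (Tao H^k cover on sub-slabs), and IsTypeIBlowup being only eventual (bound [0,t₁] by the cover).
sources: book:robinson2016-three-dimensional-navier-stokes-equations-classical-theory, arXiv:1908.04958, EscauriazaSereginSverak2003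
[crux] LOGARITHMIC L³ CEILING (the converter; provable now, staff FIRST — critic P3). A classical
solution on [0,T), Leray–Hopf from a rapidly decaying datum, obeying the quarter-rate enstrophy
bound ∫|curl u(t)|² ≤ K/√(T−t) on [0,T) and the velocity Type-I rate, satisfies ‖u(t)‖_(L³) ≤ C₁ +
C₂ log(T/(T−t)) for all t in [0,T), for some constants C₁, C₂. PROOF ROAD (skeleton v2 on
stmt-23362, registered stubs stub_l3EnergyIneq + stub_dyadicLog): d/dt‖u‖₃³ = 3∫p u·∇|u| + (viscous
≤ 0) ≤ 3‖u‖_∞‖p‖₂‖∇u‖₂, ‖p‖₂ ≤ C_R‖u‖₄² ≤ C_R‖u‖₃‖u‖₆ ≤ C_R C_S‖u‖₃‖curl u‖₂, hence d/dt‖u‖₃² ≤ 2C_R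
C_S‖u‖_∞‖curl u‖₂² ≤ C·C_I·K/(T−t) on the eventual Type-I window, so in fact ‖u(t)‖₃² ≤ C₁′ + C₂′
log(T/(T−t)) (squared-norm currency, no ν⁻¹, no Young absorption) and the stated bound follows from
‖u‖₃ ≤ 1 + ‖u‖₃²; [0,t₀] is covered by the classical bounds (the Tao H^k cover must deliver u ∈
C([0,t₀];L³), i.e. eLpNorm (u t) 3 < ⊤ for every t < T — typing note of the critic). HONEST GAP:
cube ≤ C log^{3/2} vs the template's cube ≍ log; cube ≤ C log is out of reach of this road (needs
spatial Type I; under the quarter law kinematically admissible (T−t)^{1/4}-skirts of amplitude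
(T−t)^{-3/8} have cube (T−t)^{-3 -/
@[route_item "route-NavierStokesRegularity-QuarterLogPincer"]
def LogCubeCeiling : Prop :=
  ∀ (ν T : ℝ), 0 < ν → 0 < T → ∀ (u : ℝ → EuclideanSpace ℝ (Fin 3) → EuclideanSpace ℝ (Fin 3)) (p : ℝ → EuclideanSpace ℝ (Fin 3) → ℝ), Literature.Analysis.FluidPDE.IsClassicalNSSolutionOn (Set.Ico 0 T) ν 0 u p → Literature.Analysis.FluidPDE.IsLerayHopfOn T ν 0 (u 0) u → Literature.Analysis.FluidPDE.HasRapidSpatialDecay (u 0) → ∀ K : ℝ, (∀ t ∈ Set.Ico 0 T, ∫⁻ x, ‖Literature.Analysis.FluidPDE.curl (u t) x‖ₑ ^ 2 ≤ ENNReal.ofReal (K / Real.sqrt (T - t))) → Literature.Analysis.FluidPDE.IsTypeIBlowup u T → ∃ C₁ C₂ : ℝ, ∀ t ∈ Set.Ico 0 T, MeasureTheory.eLpNorm (u t) 3 MeasureTheory.volume ≤ ENNReal.ofReal (C₁ + C₂ * Real.log (T / (T - t)))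

-- `LogCubeCeiling` holds: proved by `Summit.NavierStokesRegularity.NavierStokesRegularity.Theorems.LogCubeCeiling.logCubeCeiling_proof` (its module imports this route file, so no `_holds` link can be stated here).

/-- item stmt-NavierStokesRegularity-1574 · support · rank 9 · open · by planner
sources: Leray1934, Literature.Barriers.NavierStokesRegularity.EnstrophyODENoGlobalClosure
[crux] QUARTER LAW / enstrophy at Leray's rate (card F6; absorbs leray-quanta-energy-modulus X_H).
If a finite-energy classical solution from a rapidly decaying datum is maximal at T<oo, then
Omega(t) = int |curl u(t)|^2 <= K (T-t)^{-1/2} on [0,T) for some K (lintegral form: infinite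
enstrophy violates it). Leray1934 sec.19-22 gives the matching LOWER bound Omega >= c
nu^{3/2}(T-t)^{-1/2} (in tree: leray_blowup_rate_top family), so the claim is 'dissipation blows up
at exactly Leray's rate'. Spectral form (the card's thesis object): with alpha = xi.(grad u)xi and
Lambda(t) = sup_psi (int alpha_+|psi|^2 - nu int|grad psi|^2)/int|psi|^2 = sup spec(nu Lap +
alpha_+), one has d/dt log Omega <= 2 Lambda, blow-up forces int_{t0}^t Lambda >= (1/4) log(1/(T-t))
- C, and the crux is equivalent to int_{t0}^t (Lambda_eff - 1/(4(T-s))) ds = O(1) with Lambda_eff :=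
(1/2) d/dt log Omega <= Lambda: 'Type II <=> the stretching well binds more than a quarter per unit
log-time'. Consequences (not filed): E(Q(z,r)) = r^{-1} intint_Q |grad u|^2 <= 2K/nu-scaled for
EVERY parabolic ball below T (uniform rescaled-energy Type I => TypeIBridge); expected, to be
checked (leray-quanta graft): finitely many s -/
@[route_item "route-NavierStokesRegularity-QuarterLogPincer", crux]
def EnstrophyQuarterLaw : Prop :=
  ∀ (ν T : ℝ), 0 < ν → 0 < T → ∀ (u : ℝ → EuclideanSpace ℝ (Fin 3) → EuclideanSpace ℝ (Fin 3)) (p : ℝ → EuclideanSpace ℝ (Fin 3) → ℝ), Literature.Analysis.FluidPDE.IsMaximalSmoothSolution ν 0 u p T → Literature.Analysis.FluidPDE.IsLerayHopfOn T ν 0 (u 0) u → Literature.Analysis.FluidPDE.HasRapidSpatialDecay (u 0) → ∃ K : ℝ, ∀ t ∈ Set.Ico 0 T, ∫⁻ x, ‖Literature.Analysis.FluidPDE.curl (u t) x‖ₑ ^ 2 ≤ ENNReal.ofReal (K / Real.sqrt (T - t))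

/-- item stmt-NavierStokesRegularity-23363 · support · rank 9 · closed · proved by Summit.NavierStokesRegularity.NavierStokesRegularity.Theorems.quarterLogPincer_recordTimeTypeI_proof (prover) · by planner
sources: Leray1934, KochNadirashviliSereginSverak2009
[support] PROVED in tree (item stmt-NavierStokesRegularity-22145, theorem
Summit.NavierStokesRegularity.NavierStokesRegularity.Theorems.lerayQuarterDissipation_recordTimeTypeI_proof):
the quarter-rate enstrophy bound forces the velocity Type-I rate. Restated verbatim so that the
deciding theorem is pure logic over this file. [difficulty: provable-now] -/
@[route_item "route-NavierStokesRegularity-QuarterLogPincer", crux]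
def RecordTimeTypeI : Prop :=
  ∀ (ν T : ℝ), 0 < ν → 0 < T → ∀ (u : ℝ → EuclideanSpace ℝ (Fin 3) → EuclideanSpace ℝ (Fin 3)) (p : ℝ → EuclideanSpace ℝ (Fin 3) → ℝ), Literature.Analysis.FluidPDE.IsClassicalNSSolutionOn (Set.Ico 0 T) ν 0 u p → Literature.Analysis.FluidPDE.IsLerayHopfOn T ν 0 (u 0) u → Literature.Analysis.FluidPDE.HasRapidSpatialDecay (u 0) → ∀ K : ℝ, (∀ t ∈ Set.Ico 0 T, ∫⁻ x, ‖Literature.Analysis.FluidPDE.curl (u t) x‖ₑ ^ 2 ≤ ENNReal.ofReal (K / Real.sqrt (T - t))) → Literature.Analysis.FluidPDE.IsTypeIBlowup u T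

-- `RecordTimeTypeI` holds: proved by `Summit.NavierStokesRegularity.NavierStokesRegularity.Theorems.quarterLogPincer_recordTimeTypeI_proof` (its module imports this route file, so no `_holds` link can be stated here).

/-- item stmt-NavierStokesRegularity-23364 · assembly · rank 1 · closed · proved by Summit.NavierStokesRegularity.NavierStokesRegularity.Theorems.quarterLogPincer_assembly_proof (prover) · by planner
sources: arXiv:2003.06717
[assembly] EnstrophyQuarterLaw → RecordTimeTypeI → LogCubeCeiling → SuperlogTypeIRate →
NavierStokesRegularity -/
@[route_item "route-NavierStokesRegularity-QuarterLogPincer"]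
def Assembly : Prop :=
  EnstrophyQuarterLaw → RecordTimeTypeI → LogCubeCeiling → SuperlogTypeIRate → NavierStokesRegularity

-- `Assembly` holds: proved by `Summit.NavierStokesRegularity.NavierStokesRegularity.Theorems.quarterLogPincer_assembly_proof` (its module imports this route file, so no `_holds` link can be stated here).

/-! D-0027 §2.1 — DECIDING THEOREM (planner-authored via `route open/edit --closes-file`; by planner-ns-idea-3-g2-0 2026-08-28T00:02:32Z):
its hypotheses are this route's items and its conclusion the sub-problem Statement (glue_lint), and it elaborates with this file. -/

@[closes "route-NavierStokesRegularity-QuarterLogPincer"] theorem closes (hQ : EnstrophyQuarterLaw) (hR : RecordTimeTypeI) (hC : LogCubeSharp)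
    (hS : SuperlogCubeRate) : NavierStokesRegularity := by
  refine Summit.NavierStokesRegularity.NavierStokesRegularity.Theorems.navierStokesRegularity_of_noBlowup ?_
  intro ν T hν hT u p hcl hLH hdec
  by_contra hext
  obtain ⟨K, hK⟩ := hQ ν T hν hT u p ⟨hcl, hext⟩ hLH hdec
  have hI : Literature.Analysis.FluidPDE.IsTypeIBlowup u T := hR ν T hν hT u p hcl hLH hdec K hK
  obtain ⟨C₁, C₂, hceil⟩ := hC ν T hν hT u p hcl hLH hdec K hK hI
  obtain ⟨t, ht, hlt⟩ := hS ν T hν hT u p hcl hLH hdec hext hI C₁ C₂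
  exact absurd (hceil t ht) (not_le.mpr hlt)

end Summit.NavierStokesRegularity.NavierStokesRegularity.Theses.QuarterLogPincer
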